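import Summits.Ventures.FusionMHD.Bench.SolovevPCFIterMercierEdgeGGJ
import Literature.MathematicalPhysics.MHD.MercierFluxForm
import HarnessLib

/-!
# F1 / MERCIER at the ITER-like PCF edge — the certified edge statement in the Literature vocabulary
# `Mercier.FluxForm.SurfaceData` (Jardin 2010 (8.134) as typed by `gridfusion-lit-3`, p479625)
(venture LADDER-GRIDFUSION, rung F1.MERCIER-profile; cell `gridfusion`, seat `gridfusion-sos-6` (g2), 2026-08-27; generator
`pub/gridfusion/cert/sos-6/dm/section7.py`.)

`Bench/SolovevPCFIterMercierEdgeGGJ.lean` (p479387) proved `∀ g ≥ 3/5, 0 < mercierF g` for ITS OWN transcription `mercierF` of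
Jardin (8.134) on the edge surface.  `Literature/MathematicalPhysics/MHD/MercierFluxForm.lean` (lit-3, landed minutes later) types
(8.134) VERBATIM as `SurfaceData.mercierF` over the thirteen printed inputs.  This file supplies the edge `SurfaceData` of the model
(label `ψ = Ψ_PCF`: `Ψ′ = 2π` — the pinned «physical poloidal flux» reading —, `Ψ″ = 0`, `K′ = 0`, `p′ = −1`, `σB² = g`; `V′`, `Φ′`
the honest values of the §0 reduction; `I′` free because it is multiplied by `Ψ″ = 0`), PROVES that lit-3's functional evaluated on
it equals `mercierF g` (the `V′` normalisation cancels), and restates the certificate as `SurfaceData.MercierCriterion`.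
HONEST FRAMING as in the GGJ file §0 (CERTIFIED inequality about the MODEL's edge surface; Mercier is NECESSARY; reduction of the
surface functionals to the 1-D integrals is elementary/MODELLED; VALIDATED cross-checks in cert/F/mercier-dm-validated.md).
Orientation note (lit-3 INBOX 2026-08-27T01:00:30Z): the conventions here are self-consistently Jardin's (`B = ∇φ×∇Ψ + g∇φ`,
`μ₀J·B = +g`, `Ψ_p′ = +2π`); in Freidberg's orientation both signs flip together and (8.134) is unchanged.
-/

noncomputable section

open Real MeasureTheory Set intervalIntegral

namespace Summit.Ventures.FusionMHD.Bench.SolovevPCFIter.MercierEdge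

/-! ## The edge `SurfaceData` and the bridge

The thirteen printed inputs of (8.134) for the EDGE surface of the model, label `ψ = Ψ_PCF` (so `Ψ′ = dΨ_p/dΨ = 2π`,
`Ψ″ = 0`), `K′ = 0` (`gg′ = 0`), `p′ = −1` (`μ₀ → 1`), `σB² = g`: `V′ = πK₁/(2√(|d₃|α))` (§0: `V′ = 2π∮R dl/|∇Ψ|`,
`dl/|∇Ψ| = dt/(8√(|d₃|α)U)`), `V″ = (V″/V′)·V′`, `Φ′ = g·K₄/(4√(|d₃|α))`, `Φ″ = (Φ″/(gV′))·g·V′`, the four averages as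
in §1–§2; the toroidal-current derivative `I′` enters (8.134) only multiplied by `Ψ″ = 0` and is left as a free argument.
RESULT: `(edgeData g I′).mercierF = mercierF g`, hence `SurfaceData.MercierCriterion` for every `g ≥ 3/5`. -/

/-- `|d₃|·α = 428093984685938025/145553984504631964816` (the constant under the square root of `dl/|∇Ψ| = dt/(8√(|d₃|α)U)`). [folklore] -/
def d3alpha : ℝ := (428093984685938025 / 145553984504631964816 : ℝ)

/-- `V′ = dV/dΨ` of the edge surface: `2π∮R dl/|∇Ψ| = 4π·K₁/(8√(|d₃|α)) = πK₁/(2√(|d₃|α))`.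
[cite: Jardin2010, §5.3 eq. (5.29)] -/
def Vp : ℝ := π * K1 / (2 * Real.sqrt d3alpha)

/-- `V′ > 0`. [folklore] -/
theorem Vp_pos : 0 < Vp := by
  unfold Vp
  have h1 := K1_pos
  have h2 : 0 < Real.sqrt d3alpha := Real.sqrt_pos.mpr (by unfold d3alpha; norm_num)
  positivity

/-- **The edge surface of the ITER-like PCF model as `Mercier.FluxForm.SurfaceData`** (Jardin (8.134) inputs, label
`ψ = Ψ_PCF`; `I′` free since it is multiplied by `Ψ″ = 0`). [cite: Jardin2010, §8.5 eq. (8.134)] -/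
def edgeData (g Iprime : ℝ) : Literature.MathematicalPhysics.MHD.Mercier.FluxForm.SurfaceData where
  V' := Vp
  V'' := Vratio * Vp
  Ψ' := 2 * π
  Ψ'' := 0
  Φ' := g * K4 / (4 * Real.sqrt d3alpha)
  Φ'' := g * phihat * Vp
  I' := Iprime
  K' := 0
  p' := -1
  gB2 := B2G g
  gσB2 := g * A6
  gσ2B2 := Xavg g
  invB2 := Yavg g

/-- **Bridge:** Jardin's (8.134) evaluated on the edge data IS this file's `mercierF` (the `V′` normalisation cancels).
[cite: Jardin2010, §8.5 eq. (8.134)] -/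
theorem mercierF_edgeData (g Iprime : ℝ) : (edgeData g Iprime).mercierF = mercierF g := by
  have hv : Vp ≠ 0 := Vp_pos.ne'
  unfold Literature.MathematicalPhysics.MHD.Mercier.FluxForm.SurfaceData.mercierF edgeData mercierF
  simp only
  field_simp
  ring

/-- **The Literature-vocabulary statement:** for every `g = F = RB_φ ≥ 3/5` and every value of the (irrelevant) `I′`,
the edge surface of the ITER-like PCF Solov'ev model satisfies `Mercier.FluxForm.SurfaceData.MercierCriterion` —
Jardin (8.134) `F > 0`, the flux-coordinate Mercier criterion (NECESSARY for ideal interchange stability; MODELLED as in §0).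
[cite: Jardin2010, §8.5 eq. (8.134)] -/
theorem mercierCriterion_edge_of_le {g : ℝ} (hg : (3 / 5 : ℝ) ≤ g) (Iprime : ℝ) :
    (edgeData g Iprime).MercierCriterion := by
  unfold Literature.MathematicalPhysics.MHD.Mercier.FluxForm.SurfaceData.MercierCriterion
  rw [mercierF_edgeData]
  exact mercierF_pos_of_le hg


end Summit.Ventures.FusionMHD.Bench.SolovevPCFIter.MercierEdge

end
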